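import Literature.Combinatorics.SimpleGraph.HamiltonianGadgetSubstitutionCount
import Mathlib.Algebra.BigOperators.Ring.Finset
import Mathlib.Data.Finset.Range
import Mathlib.Tactic.Ring
import HarnessLib

/-!
# Gadget substitution for Hamiltonian-path counts, VIII: several gadgets

Iteration of the counting identity of `HamiltonianGadgetSubstitutionCount.lean`. A **gadget family**
`𝒢` lists, for `i = 0, 1, …`, slots `𝒢.S i` (edges of the base graph `M` inside `V`), a gadget graph
`𝒢.GX i` on fresh vertices `𝒢.VX i`; `graphUpTo M V 𝒢 k` is `M` with the first `k` gadgets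
substituted and `vertsUpTo V 𝒢 k` its vertex set. If the family is valid (`GadgetFamily.Valid`:
fresh pairwise disjoint gadget vertex sets, slots of different gadgets edge-disjoint, and each gadget
satisfying the hypotheses of `Substitution`), then each step is a `Substitution`
(`GadgetFamily.Valid.substitution`) and **the constrained Hamiltonian-path counts of the substituted
graph are the census-weighted sums over the used slots** (`GadgetFamily.Valid.hamCountRF_graphUpTo`):

`hamCountRF (graphUpTo k) (vertsUpTo k) s t R F
   = Σ_{U ⊆ slots<k} (∏_{i<k} coverCount (GX i) (VX i) (U ∩ S i)) · hamCountRF M V s t (R ∪ U) (F ∪ (slots<k \ U))`.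

## References

* M. R. Garey, D. S. Johnson, *Computers and Intractability*, Freeman 1979, §3.2.2.
* M. Liśkiewicz, M. Ogihara, S. Toda, TCS 304 (2003) 129–156, §3 (proof of Lemma 4).
-/

namespace Literature.Combinatorics.SimpleGraph

open scoped Classical

variable {α : Type*} [DecidableEq α]

/-! ### A sum over the subsets of a disjoint union -/

omit [DecidableEq α] in
/-- Summing over the subsets of a disjoint union `A ∪ B` is summing over pairs of subsets.
[folklore] -/
theorem sum_powerset_union_of_disjoint [DecidableEq α] {β : Type*} [AddCommMonoid β] {A B : Finset α}
    (hAB : Disjoint A B) (f : Finset α → β) :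
    ∑ U ∈ (A ∪ B).powerset, f U = ∑ X ∈ A.powerset, ∑ Y ∈ B.powerset, f (X ∪ Y) := by
  rw [← Finset.sum_product']
  symm
  refine Finset.sum_nbij' (fun p => p.1 ∪ p.2) (fun U => (U ∩ A, U ∩ B)) ?_ ?_ ?_ ?_ ?_
  · rintro ⟨X, Y⟩ hp
    simp only [Finset.mem_product, Finset.mem_powerset] at hp ⊢
    exact Finset.union_subset_union hp.1 hp.2
  · intro U hU
    simp only [Finset.mem_powerset] at hU
    simp only [Finset.mem_product, Finset.mem_powerset]
    exact ⟨Finset.inter_subset_right, Finset.inter_subset_right⟩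
  · rintro ⟨X, Y⟩ hp
    simp only [Finset.mem_product, Finset.mem_powerset] at hp
    simp only [Prod.mk.injEq]
    constructor
    · ext x
      simp only [Finset.mem_inter, Finset.mem_union]
      constructor
      · rintro ⟨hx | hx, hxA⟩
        · exact hx
        · exact absurd hxA (Finset.disjoint_right.1 hAB (hp.2 hx))
      · exact fun hx => ⟨Or.inl hx, hp.1 hx⟩
    · ext x
      simp only [Finset.mem_inter, Finset.mem_union]
      constructor
      · rintro ⟨hx | hx, hxB⟩
        · exact absurd hxB (Finset.disjoint_left.1 hAB (hp.1 hx))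
        · exact hx
      · exact fun hx => ⟨Or.inr hx, hp.2 hx⟩
  · intro U hU
    simp only [Finset.mem_powerset] at hU
    ext x
    simp only [Finset.mem_union, Finset.mem_inter]
    constructor
    · rintro (⟨hx, -⟩ | ⟨hx, -⟩) <;> exact hx
    · intro hx
      rcases Finset.mem_union.1 (hU hx) with h | h
      · exact Or.inl ⟨hx, h⟩
      · exact Or.inr ⟨hx, h⟩
  · intro p _; rfl

/-! ### Hamiltonian paths see only the adjacency inside the vertex set -/

/-- Graphs with the same adjacency inside `V` have the same constrained Hamiltonian paths through
`V`. [folklore] -/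
theorem hamSetRF_congr {G G' : _root_.SimpleGraph α} {V : Finset α} (h : ∀ a ∈ V, ∀ b ∈ V, G.Adj a b ↔ G'.Adj a b)
    (s t : α) (R F : Finset (α × α)) : hamSetRF G V s t R F = hamSetRF G' V s t R F := by
  ext l
  simp only [hamSetRF, Set.mem_setOf_eq]
  constructor
  · rintro ⟨hl, hR, hF⟩
    exact ⟨hl.mono fun a ha b hb hab => (h a ha b hb).1 hab, hR, hF⟩
  · rintro ⟨hl, hR, hF⟩
    exact ⟨hl.mono fun a ha b hb hab => (h a ha b hb).2 hab, hR, hF⟩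

/-! ### Gadget families -/

/-- **A gadget family**: slots, gadget graph and gadget vertices of the `i`-th gadget, `i = 0, 1, …`.
[cite: GareyJohnson1979, §3.2.2 (local replacement)] -/
structure GadgetFamily (α : Type*) where
  /-- the slots of the `i`-th gadget -/
  S : ℕ → Finset (α × α)
  /-- the gadget graph of the `i`-th gadget -/
  GX : ℕ → _root_.SimpleGraph α
  /-- the gadget vertices of the `i`-th gadget -/
  VX : ℕ → Finset α

namespace GadgetFamily

variable (M : _root_.SimpleGraph α) (V : Finset α) (𝒢 : GadgetFamily α)

/-- **The base graph with the first `k` gadgets substituted**: the edges of `M` inside `V` that are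
slots of none of them, and the gadget edges. [cite: GareyJohnson1979, §3.2.2 (local replacement)] -/
def graphUpTo (k : ℕ) : _root_.SimpleGraph α where
  Adj a b := (M.Adj a b ∧ a ∈ V ∧ b ∈ V ∧ ∀ i < k, ¬ slotOf (𝒢.S i) a b) ∨ ∃ i < k, (𝒢.GX i).Adj a b
  symm := ⟨fun a b h => by
    rcases h with ⟨h1, h2, h3, h4⟩ | ⟨i, hi, h⟩
    · exact Or.inl ⟨h1.symm, h3, h2, fun i hi hs => h4 i hi (slotOf_comm.1 hs)⟩
    · exact Or.inr ⟨i, hi, h.symm⟩⟩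
  loopless := ⟨fun a h => by
    rcases h with ⟨h1, -⟩ | ⟨i, -, h⟩
    · exact M.loopless.1 a h1
    · exact (𝒢.GX i).loopless.1 a h⟩

/-- The vertex set after the first `k` substitutions. [folklore] -/
def vertsUpTo (k : ℕ) : Finset α :=
  V ∪ (Finset.range k).biUnion 𝒢.VX

/-- The slots of the first `k` gadgets. [folklore] -/
def slotsBelow (k : ℕ) : Finset (α × α) :=
  (Finset.range k).biUnion 𝒢.S

/-- **A valid gadget family of `n` gadgets**: fresh, pairwise disjoint gadget vertex sets; slots are
edges of `M` inside `V`, edge-disjoint across gadgets and with disjoint end points within a gadget;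
each gadget attaches to its ports only, one port edge at each port, and is exclusive.
[cite: GareyJohnson1979, §3.2.2 (local replacement)] -/
structure Valid (n : ℕ) : Prop where
  V_disjoint : ∀ i < n, Disjoint V (𝒢.VX i)
  VX_disjoint : ∀ i < n, ∀ j < n, i ≠ j → Disjoint (𝒢.VX i) (𝒢.VX j)
  slot_adj : ∀ i < n, ∀ e ∈ 𝒢.S i, e.1 ∈ V ∧ e.2 ∈ V ∧ M.Adj e.1 e.2
  slot_across : ∀ i < n, ∀ j < n, i ≠ j → ∀ e ∈ 𝒢.S i, ¬ slotOf (𝒢.S j) e.1 e.2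
  slot_disjoint : ∀ i < n, ∀ e ∈ 𝒢.S i, ∀ e' ∈ 𝒢.S i, e ≠ e' →
    e.1 ≠ e'.1 ∧ e.1 ≠ e'.2 ∧ e.2 ≠ e'.1 ∧ e.2 ≠ e'.2
  gadget_adj : ∀ i < n, ∀ a b, (𝒢.GX i).Adj a b →
    (a ∈ 𝒢.VX i ∨ b ∈ 𝒢.VX i) ∧ (a ∈ 𝒢.VX i ∨ a ∈ ports (𝒢.S i)) ∧ (b ∈ 𝒢.VX i ∨ b ∈ ports (𝒢.S i))
  port_unique : ∀ i < n, ∀ p ∈ ports (𝒢.S i), ∀ x y, (𝒢.GX i).Adj p x → (𝒢.GX i).Adj p y → x = y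
  exclusive : ∀ i < n, Exclusive (𝒢.GX i) (𝒢.VX i) (𝒢.S i)

variable {M V 𝒢}

/-- Membership in the vertex set after `k` substitutions. [folklore] -/
theorem mem_vertsUpTo_iff {k : ℕ} {a : α} : a ∈ vertsUpTo V 𝒢 k ↔ a ∈ V ∨ ∃ i < k, a ∈ 𝒢.VX i := by
  simp [vertsUpTo]

/-- Membership in the slots of the first `k` gadgets. [folklore] -/
theorem mem_slotsBelow_iff {k : ℕ} {e : α × α} : e ∈ slotsBelow 𝒢 k ↔ ∃ i < k, e ∈ 𝒢.S i := by
  simp [slotsBelow]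

/-- Ports of a gadget of a valid family lie in `V`. [folklore] -/
theorem Valid.ports_subset {n : ℕ} (hv : Valid M V 𝒢 n) {i : ℕ} (hi : i < n) {p : α} (hp : p ∈ ports (𝒢.S i)) :
    p ∈ V := by
  obtain ⟨e, he, rfl | rfl⟩ := mem_ports_iff.1 hp
  · exact (hv.slot_adj i hi e he).1
  · exact (hv.slot_adj i hi e he).2.1

/-- A gadget edge of a valid family never joins the two ends of a slot. [folklore] -/
theorem Valid.not_slotOf_of_gadget_adj {n : ℕ} (hv : Valid M V 𝒢 n) {i j : ℕ} (hi : i < n) (hj : j < n) {a b : α}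
    (h : (𝒢.GX i).Adj a b) : ¬ slotOf (𝒢.S j) a b := by
  intro hs
  have hab : a ∈ V ∧ b ∈ V := by
    rcases hs with hs | hs
    · exact ⟨(hv.slot_adj j hj _ hs).1, (hv.slot_adj j hj _ hs).2.1⟩
    · exact ⟨(hv.slot_adj j hj _ hs).2.1, (hv.slot_adj j hj _ hs).1⟩
  rcases (hv.gadget_adj i hi a b h).1 with ha | hb
  · exact Finset.disjoint_left.1 (hv.V_disjoint i hi) hab.1 ha
  · exact Finset.disjoint_left.1 (hv.V_disjoint i hi) hab.2 hb

/-- **Each step of a valid family is a gadget substitution.** [folklore] -/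
theorem Valid.substitution {n : ℕ} (hv : Valid M V 𝒢 n) {k : ℕ} (hk : k < n) :
    Substitution (graphUpTo M V 𝒢 k) (vertsUpTo V 𝒢 k) (𝒢.S k) (𝒢.GX k) (𝒢.VX k) (graphUpTo M V 𝒢 (k + 1)) := by
  refine ⟨?_, fun e he => ?_, hv.slot_disjoint k hk, hv.gadget_adj k hk, hv.port_unique k hk, fun a b => ?_,
    hv.exclusive k hk⟩
  · -- fresh vertices
    rw [Finset.disjoint_left]
    intro a ha haX
    rcases mem_vertsUpTo_iff.1 ha with haV | ⟨i, hi, hai⟩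
    · exact Finset.disjoint_left.1 (hv.V_disjoint k hk) haV haX
    · exact Finset.disjoint_left.1 (hv.VX_disjoint i (by omega) k hk (by omega)) hai haX
  · -- slots are edges of the current base graph inside its vertex set
    obtain ⟨h1, h2, hadj⟩ := hv.slot_adj k hk e he
    exact ⟨mem_vertsUpTo_iff.2 (Or.inl h1), mem_vertsUpTo_iff.2 (Or.inl h2),
      Or.inl ⟨hadj, h1, h2, fun i hi => hv.slot_across k hk i (by omega) (by omega) e he⟩⟩
  · -- the substituted adjacency
    constructor
    · rintro (⟨hM, haV, hbV, hall⟩ | ⟨i, hi, h⟩)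
      · exact Or.inl ⟨Or.inl ⟨hM, haV, hbV, fun i hi => hall i (by omega)⟩, mem_vertsUpTo_iff.2 (Or.inl haV),
          mem_vertsUpTo_iff.2 (Or.inl hbV), hall k (Nat.lt_succ_self k)⟩
      · rcases Nat.lt_succ_iff_lt_or_eq.1 hi with hi | rfl
        · have hin : ∀ x, x ∈ 𝒢.VX i ∨ x ∈ ports (𝒢.S i) → x ∈ vertsUpTo V 𝒢 k := by
            rintro x (hx | hx)
            · exact mem_vertsUpTo_iff.2 (Or.inr ⟨i, hi, hx⟩)
            · exact mem_vertsUpTo_iff.2 (Or.inl (hv.ports_subset (by omega) hx))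
          obtain ⟨-, ha, hb⟩ := hv.gadget_adj i (by omega) a b h
          exact Or.inl ⟨Or.inr ⟨i, hi, h⟩, hin a ha, hin b hb, hv.not_slotOf_of_gadget_adj (by omega) hk h⟩
        · exact Or.inr h
    · rintro (⟨hG | ⟨i, hi, h⟩, -, -, hns⟩ | h)
      · obtain ⟨hM, haV, hbV, hall⟩ := hG
        refine Or.inl ⟨hM, haV, hbV, fun i hi => ?_⟩
        rcases Nat.lt_succ_iff_lt_or_eq.1 hi with hi | rfl
        · exact hall i hi
        · exact hns
      · exact Or.inr ⟨i, by omega, h⟩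
      · exact Or.inr ⟨k, Nat.lt_succ_self k, h⟩

/-- **The counting identity for several gadgets**: the constrained Hamiltonian-path counts of the
graph with the first `k` gadgets substituted, as census-weighted sums over the used slots.
[cite: GareyJohnson1979, §3.2.2; LiskiewiczOgiharaToda2003, §3 (proof of Lemma 4)] -/
theorem Valid.hamCountRF_graphUpTo {n : ℕ} (hv : Valid M V 𝒢 n) {s t : α} (hs : s ∈ V) (ht : t ∈ V) :
    ∀ k ≤ n, ∀ R F : Finset (α × α),
      (∀ e ∈ R, e.1 ∈ V ∧ e.2 ∈ V ∧ ∀ i < k, ¬ slotOf (𝒢.S i) e.1 e.2) →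
      (∀ e ∈ F, e.1 ∈ V ∧ e.2 ∈ V ∧ ∀ i < k, ¬ slotOf (𝒢.S i) e.1 e.2) →
      hamCountRF (graphUpTo M V 𝒢 k) (vertsUpTo V 𝒢 k) s t R F =
        ∑ U ∈ (slotsBelow 𝒢 k).powerset,
          (∏ i ∈ Finset.range k, coverCount (𝒢.GX i) (𝒢.VX i) (U ∩ 𝒢.S i)) *
            hamCountRF M V s t (R ∪ U) (F ∪ (slotsBelow 𝒢 k \ U)) := by
  intro k
  induction k with
  | zero =>
    intro _ R F _ _
    have hV : vertsUpTo V 𝒢 0 = V := by simp [vertsUpTo]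
    have hS : slotsBelow 𝒢 0 = ∅ := by simp [slotsBelow]
    rw [hV, hS, Finset.powerset_empty, Finset.sum_singleton, Finset.range_zero, Finset.prod_empty, one_mul,
      Finset.union_empty, Finset.empty_sdiff, Finset.union_empty, hamCountRF, hamCountRF,
      hamSetRF_congr (G' := M) (fun a ha b hb => ?_)]
    simp [graphUpTo, ha, hb]
  | succ k ih =>
    intro hk R F hR hF
    have hk' : k < n := hk
    have hsub := hv.substitution hk'
    -- peel off gadget `k`
    rw [show vertsUpTo V 𝒢 (k + 1) = vertsUpTo V 𝒢 k ∪ 𝒢.VX k by simp [vertsUpTo, Finset.range_add_one, Finset.biUnion_insert, Finset.union_comm, Finset.union_assoc]]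
    rw [hsub.hamCountRF_eq_sum (mem_vertsUpTo_iff.2 (Or.inl hs)) (mem_vertsUpTo_iff.2 (Or.inl ht))
      (fun e he => ⟨mem_vertsUpTo_iff.2 (Or.inl (hR e he).1), mem_vertsUpTo_iff.2 (Or.inl (hR e he).2.1),
        (hR e he).2.2 k (Nat.lt_succ_self k)⟩)
      (fun e he => ⟨mem_vertsUpTo_iff.2 (Or.inl (hF e he).1), mem_vertsUpTo_iff.2 (Or.inl (hF e he).2.1),
        (hF e he).2.2 k (Nat.lt_succ_self k)⟩)]
    -- apply the induction hypothesis to each term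
    have hterm : ∀ U' ∈ (𝒢.S k).powerset,
        hamCountRF (graphUpTo M V 𝒢 k) (vertsUpTo V 𝒢 k) s t (R ∪ U') (F ∪ (𝒢.S k \ U')) =
          ∑ U ∈ (slotsBelow 𝒢 k).powerset,
            (∏ i ∈ Finset.range k, coverCount (𝒢.GX i) (𝒢.VX i) (U ∩ 𝒢.S i)) *
              hamCountRF M V s t (R ∪ U' ∪ U) (F ∪ (𝒢.S k \ U') ∪ (slotsBelow 𝒢 k \ U)) := by
      intro U' hU'
      rw [Finset.mem_powerset] at hU'
      have hslot : ∀ e ∈ 𝒢.S k, e.1 ∈ V ∧ e.2 ∈ V ∧ ∀ i < k, ¬ slotOf (𝒢.S i) e.1 e.2 := fun e he =>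
        ⟨(hv.slot_adj k hk' e he).1, (hv.slot_adj k hk' e he).2.1,
          fun i hi => hv.slot_across k hk' i (by omega) (by omega) e he⟩
      refine ih (by omega) (R ∪ U') (F ∪ (𝒢.S k \ U')) (fun e he => ?_) (fun e he => ?_)
      · rcases Finset.mem_union.1 he with he | he
        · exact ⟨(hR e he).1, (hR e he).2.1, fun i hi => (hR e he).2.2 i (by omega)⟩
        · exact hslot e (hU' he)
      · rcases Finset.mem_union.1 he with he | he
        · exact ⟨(hF e he).1, (hF e he).2.1, fun i hi => (hF e he).2.2 i (by omega)⟩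
        · exact hslot e (Finset.mem_sdiff.1 he).1
    rw [Finset.sum_congr rfl fun U' hU' => by rw [hterm U' hU']]
    -- regroup the double sum as a sum over the subsets of `slotsBelow (k+1) = slotsBelow k ∪ S k`
    have hdisj : Disjoint (slotsBelow 𝒢 k) (𝒢.S k) := by
      rw [Finset.disjoint_left]
      intro e he he'
      obtain ⟨i, hi, hei⟩ := mem_slotsBelow_iff.1 he
      exact hv.slot_across i (by omega) k hk' (by omega) e hei (Or.inl he')
    have hbelow : slotsBelow 𝒢 (k + 1) = slotsBelow 𝒢 k ∪ 𝒢.S k := by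
      simp [slotsBelow, Finset.range_add_one, Finset.biUnion_insert, Finset.union_comm]
    rw [hbelow, sum_powerset_union_of_disjoint hdisj, Finset.sum_comm]
    refine Finset.sum_congr rfl fun U' hU' => ?_
    rw [Finset.mul_sum]
    refine Finset.sum_congr rfl fun U hU => ?_
    rw [Finset.mem_powerset] at hU hU'
    -- identify the census factors and the constraint sets
    have hXS : (U ∪ U') ∩ 𝒢.S k = U' := by
      ext e
      simp only [Finset.mem_inter, Finset.mem_union]
      constructor
      · rintro ⟨he | he, heS⟩
        · exact absurd heS (Finset.disjoint_left.1 hdisj (hU he))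
        · exact he
      · exact fun he => ⟨Or.inr he, hU' he⟩
    have hXi : ∀ i ∈ Finset.range k, (U ∪ U') ∩ 𝒢.S i = U ∩ 𝒢.S i := by
      intro i hi
      rw [Finset.mem_range] at hi
      ext e
      simp only [Finset.mem_inter, Finset.mem_union]
      constructor
      · rintro ⟨he | he, heS⟩
        · exact ⟨he, heS⟩
        · exact absurd (Or.inl heS : slotOf (𝒢.S i) e.1 e.2) (hv.slot_across k hk' i (by omega) (by omega) e (hU' he))
      · rintro ⟨he, heS⟩
        exact ⟨Or.inl he, heS⟩
    rw [Finset.prod_range_succ, hXS,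
      Finset.prod_congr (f := fun i => coverCount (𝒢.GX i) (𝒢.VX i) ((U ∪ U') ∩ 𝒢.S i))
        (g := fun i => coverCount (𝒢.GX i) (𝒢.VX i) (U ∩ 𝒢.S i)) rfl fun i hi => by simp only [hXi i hi]]
    have hRU : R ∪ U' ∪ U = R ∪ (U ∪ U') := by
      ext e; simp only [Finset.mem_union]; tauto
    have hFU : F ∪ (𝒢.S k \ U') ∪ (slotsBelow 𝒢 k \ U) = F ∪ ((slotsBelow 𝒢 k ∪ 𝒢.S k) \ (U ∪ U')) := by
      ext e
      simp only [Finset.mem_union, Finset.mem_sdiff, not_or]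
      constructor
      · rintro ((he | ⟨he, hne⟩) | ⟨he, hne⟩)
        · exact Or.inl he
        · exact Or.inr ⟨Or.inr he, fun h => Finset.disjoint_left.1 hdisj (hU h) he, hne⟩
        · exact Or.inr ⟨Or.inl he, hne, fun h => Finset.disjoint_left.1 hdisj he (hU' h)⟩
      · rintro (he | ⟨he | he, hne, hne'⟩)
        · exact Or.inl (Or.inl he)
        · exact Or.inr ⟨he, hne⟩
        · exact Or.inl (Or.inr ⟨he, hne'⟩)
    rw [hRU, hFU]
    ring

end GadgetFamily

end Literature.Combinatorics.SimpleGraph
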